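import Mathlib
import HarnessLib
import Summits.HubbardSuperconductivity.HubbardSuperconductivity.Theorems.KLProgrammeKLRegimeVolumeLimitTwoPointHamiltonianBound
import Summits.HubbardSuperconductivity.HubbardSuperconductivity.Theorems.KLProgrammeThermalGreenMatsubaraTimeAllU

/-!
# `stub_vl_bound` of `KLRegimeVolumeLimitV12` from the SERIES form of (H1) — the closing adapter (seat hubbard-kl-k3c5-p2, g3)

Route `KLProgramme`, gen-4 child 5 (stmt-HubbardSuperconductivity-19858), stub `stub_vl_bound`.  `stub_vl_bound_of_H1`
(`…VolumeLimitTwoPointHamiltonianBound`) takes (H1) as a `Tendsto` of the `1+1` Grassmann word to the two-time Hamiltonian trace.  k3c5-p1's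
(H1) (`hasSum_twoPointLimitDet_series_time`, H1-DESIGN.md) is a `HasSum` statement about the LIMIT SERIES of that word; the series IS the limit
by k3c5-p2's all-`U` time-resolved Matsubara limit `tendsto_gaussExpect_twoPoint_mul_grassmannExp_allU_time` (p470680).  This module makes the
closure one `exact`:

* `H1_tendsto_of_hasSum` — `HasSum (series x y s) v ⟹ W_M(x,y,s) → v` (`s ∈ [0,β)`);
* **`stub_vl_bound_of_hasSumH1`** — `(∀ β > 0, U, μ, L ≥ 3, x, y, s ∈ (0,β), HasSum (series) (e^{−βUL²/4}·Tr(e^{−(β−s)H'}c†_{x↑}e^{−sH'}c_{y↑})/Z_{H₀}))`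
  ⟹ the REGISTERED `stub_vl_bound` text verbatim (every coupling).

Everything is proved; no definition.
-/

noncomputable section

namespace Summit.HubbardSuperconductivity.HubbardSuperconductivity.Theorems.TwoPointAssembly

set_option linter.dupNamespace false -- summit = problem name (single-conjunct summit), D-0017

open Finset Filter Topology MeasureTheory Literature.MathematicalPhysics.QuantumLattice Literature.Probability.LatticeModels GrassmannAlgebra
open Summit.HubbardSuperconductivity.HubbardSuperconductivity.Theorems.MatsubaraAllU
open Summit.HubbardSuperconductivity.HubbardSuperconductivity.Theorems.KLRegimeSplit
open Summit.HubbardSuperconductivity.HubbardSuperconductivity.Theorems.KLProgrammeLegKernels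
open scoped Nat

variable {L : ℕ} [NeZero L]

/-- **From the series to the word**: if the limit series of the `1+1` word at external times `(s, 0)` (spin `↑↑`, sites `x, y`) has sum `v`, then
`∫dμ_{C_M} ψ⁺_{(x,s)↑}ψ⁻_{(y,0)↑} e^{−V} → v` as `M → ∞` (`β > 0`, `s ∈ [0,β)`, every `U`). -/
theorem H1_tendsto_of_hasSum {β : ℝ} (hβ : 0 < β) (μ U : ℝ) (x y : TorusSite 2 L) {s : ℝ} (hs : s ∈ Set.Ico (0 : ℝ) β) {v : ℂ}
    (h : HasSum (fun n : ℕ => ((-1 : ℂ) ^ n * ((n ! : ℂ))⁻¹) * ((U : ℂ) ^ n * ∑ xv : Fin n → TorusSite 2 L,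
        ∫ τ in Set.Icc (0 : Fin n → ℝ) (fun _ => β),
          (Matrix.of fun i j : Fin (n * 2 + 1) =>
            vertexLimitEntry L β μ ((Fin.append xv ![x, y] : Fin (n + 2) → TorusSite 2 L) (twoPointPlusEnum n 0 i).1)
              ((Fin.append xv ![x, y] : Fin (n + 2) → TorusSite 2 L) (twoPointMinusEnum n 0 j).1)
              (twoPointPlusEnum n 0 i).2 (twoPointMinusEnum n 0 j).2
              ((Fin.append τ ![s, 0] : Fin (n + 2) → ℝ) (twoPointMinusEnum n 0 j).1 -
                (Fin.append τ ![s, 0] : Fin (n + 2) → ℝ) (twoPointPlusEnum n 0 i).1)).det)) v) :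
    Tendsto (fun M : ℕ => gaussExpect ℂ (hubbardCovariance L M β μ 0)
        (positionField L M β 0 0 x s * positionField L M β 1 0 y 0 * grassmannExp (-(hubbardInteraction L M β U)))) atTop (𝓝 v) := by
  rw [← h.tsum_eq]
  exact tendsto_gaussExpect_twoPoint_mul_grassmannExp_allU_time hβ μ U 0 0 x y hs (Set.left_mem_Ico.2 hβ)

/-- **`stub_vl_bound` FROM THE SERIES FORM OF (H1)** — the REGISTERED stub text verbatim, for EVERY coupling: it suffices that for every `β > 0`,
real `U, μ`, `L ≥ 3`, torus sites `x, y` and `s ∈ (0, β)` the limit series of the `1+1` word sums to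
`e^{−βUL²/4}·Tr(e^{−(β−s)H'} c†_{x↑} e^{−sH'} c_{y↑})/Z_{H₀}`, `H' = hubbardTorusWith 2 L 1 U (μ + U/2)`, `H₀ = hubbardTorusWith 2 L 1 0 μ`
(k3c5-p1's `hasSum_twoPointLimitDet_series_time` at spins `(0,0)`). -/
theorem stub_vl_bound_of_hasSumH1
    (hH1 : ∀ β : ℝ, 0 < β → ∀ (U μ : ℝ) (L : ℕ) [NeZero L], 3 ≤ L → ∀ (x y : TorusSite 2 L), ∀ s ∈ Set.Ioo (0 : ℝ) β,
      HasSum (fun n : ℕ => ((-1 : ℂ) ^ n * ((n ! : ℂ))⁻¹) * ((U : ℂ) ^ n * ∑ xv : Fin n → TorusSite 2 L,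
        ∫ τ in Set.Icc (0 : Fin n → ℝ) (fun _ => β),
          (Matrix.of fun i j : Fin (n * 2 + 1) =>
            vertexLimitEntry L β μ ((Fin.append xv ![x, y] : Fin (n + 2) → TorusSite 2 L) (twoPointPlusEnum n 0 i).1)
              ((Fin.append xv ![x, y] : Fin (n + 2) → TorusSite 2 L) (twoPointMinusEnum n 0 j).1)
              (twoPointPlusEnum n 0 i).2 (twoPointMinusEnum n 0 j).2
              ((Fin.append τ ![s, 0] : Fin (n + 2) → ℝ) (twoPointMinusEnum n 0 j).1 -
                (Fin.append τ ![s, 0] : Fin (n + 2) → ℝ) (twoPointPlusEnum n 0 i).1)).det))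
        ((Real.exp (-(β * U / 4 * (L : ℝ) ^ 2)) : ℂ) *
          (Matrix.gibbsWeight (β - s) (hubbardTorusWith 2 L 1 U (μ + U / 2)) * creation (orb (FermionTorus.ofTorusSite x) 0) *
            (Matrix.gibbsWeight s (hubbardTorusWith 2 L 1 U (μ + U / 2)) * annihilation (orb (FermionTorus.ofTorusSite y) 0))).trace /
          Matrix.partitionFn β (hubbardTorusWith 2 L 1 0 μ))) :
    ∀ (G : GeoConsts) (P : SplitConsts) (Q : EngConsts) (R : RenConsts), G.WF → P.WF → Q.WF → R.WF →
      ∃ c₅ : ℝ, 0 < c₅ ∧ ∀ c : ℝ, 0 < c → c ≤ c₅ → ∃ U₀ : ℝ, 0 < U₀ ∧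
        ∀ μ ∈ klWindowC, ∀ U : ℝ, 0 < U → U ≤ U₀ → ∀ β : ℝ, klBetaMin ≤ β → β ≤ Real.exp (c / U ^ 2) →
          ∀ K : TrigPolyC4v, klPredsV12.frameOK R U (nScales β) μ K →
            ∀ (Lstar : ℕ) (Mstar : ℕ → ℕ), TowerP klPredsV12 G P Q R β U μ K Lstar Mstar →
              ∃ B : ℝ, ∃ L₀ : ℕ, ∃ Mth : ℕ → ℕ, ∀ (L : ℕ) [NeZero L], L₀ ≤ L → ∀ (M : ℕ) [NeZero M], Mth L ≤ M →
                ∀ (k : FreqMomentum L M) (σ : Fin 2), ‖klSelfEnergy L M β U μ K klE0 (nScales β + 1) k σ‖ ≤ B :=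
  stub_vl_bound_of_H1 fun β hβ U μ L _ hL x y s hs =>
    H1_tendsto_of_hasSum hβ μ U x y ⟨hs.1.le, hs.2⟩ (hH1 β hβ U μ L hL x y s hs)

/-! ## The graph-level value form (p484918's `hasSum_hubbard_twoPoint_twoTime_renormalised_trace` at `ν = ½`, `t = 1`, the torus graph) -/

/-- **The two value forms agree**: p484918's graph-level value at `G = fermionTorusGraph 2 L`, `t = 1`, `ν = ½`, divided by `Z_{H₀}`, IS the
torus-level value consumed by `stub_vl_bound_of_hasSumH1`. -/
theorem H1value_graph_eq_torus (β U μ s : ℝ) (x y : TorusSite 2 L) :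
    (Real.exp (-(β * (U * (1 / 2) ^ 2 * Fintype.card (FermionTorus 2 L)))) : ℂ) *
        (Matrix.gibbsWeight (β - s) (hamiltonianWith (fermionTorusGraph 2 L) 1 U (μ + U * (1 / 2))) *
            creation (orb (FermionTorus.ofTorusSite x) 0) *
          (Matrix.gibbsWeight s (hamiltonianWith (fermionTorusGraph 2 L) 1 U (μ + U * (1 / 2))) *
            annihilation (orb (FermionTorus.ofTorusSite y) 0))).trace /
        Matrix.partitionFn β (hubbardTorusWith 2 L 1 0 μ) =
      (Real.exp (-(β * U / 4 * (L : ℝ) ^ 2)) : ℂ) *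
        (Matrix.gibbsWeight (β - s) (hubbardTorusWith 2 L 1 U (μ + U / 2)) * creation (orb (FermionTorus.ofTorusSite x) 0) *
          (Matrix.gibbsWeight s (hubbardTorusWith 2 L 1 U (μ + U / 2)) * annihilation (orb (FermionTorus.ofTorusSite y) 0))).trace /
        Matrix.partitionFn β (hubbardTorusWith 2 L 1 0 μ) := by
  have h1 : hubbardTorusWith 2 L 1 U (μ + U / 2) = hamiltonianWith (fermionTorusGraph 2 L) 1 U (μ + U * (1 / 2)) := by
    rw [show μ + U / 2 = μ + U * (1 / 2) by ring]
    rfl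
  have hcard : (Fintype.card (FermionTorus 2 L) : ℝ) = (L : ℝ) ^ 2 := by
    rw [show Fintype.card (FermionTorus 2 L) = Fintype.card (Fin 2 → Fin L) from Fintype.card_lex _, Fintype.card_fun,
      Fintype.card_fin, Fintype.card_fin]
    push_cast
    ring
  have h3 : (Real.exp (-(β * (U * (1 / 2) ^ 2 * Fintype.card (FermionTorus 2 L)))) : ℂ) = (Real.exp (-(β * U / 4 * (L : ℝ) ^ 2)) : ℂ) := by
    rw [hcard]
    congr 1
    congr 1
    ring
  rw [h1, h3]

/-- **`stub_vl_bound` FROM THE GRAPH-LEVEL SERIES FORM OF (H1)** (value written as in p484918: `e^{−βU(½)²|Λ|}`, `hamiltonianWith (fermionTorusGraph 2 L) 1 U (μ + U·½)`,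
divided by `Z_{H₀}`) — the same closure, no cosmetic conversion needed on the supplier's side. -/
theorem stub_vl_bound_of_hasSumH1_graphForm
    (hH1 : ∀ β : ℝ, 0 < β → ∀ (U μ : ℝ) (L : ℕ) [NeZero L], 3 ≤ L → ∀ (x y : TorusSite 2 L), ∀ s ∈ Set.Ioo (0 : ℝ) β,
      HasSum (fun n : ℕ => ((-1 : ℂ) ^ n * ((n ! : ℂ))⁻¹) * ((U : ℂ) ^ n * ∑ xv : Fin n → TorusSite 2 L,
        ∫ τ in Set.Icc (0 : Fin n → ℝ) (fun _ => β),
          (Matrix.of fun i j : Fin (n * 2 + 1) =>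
            vertexLimitEntry L β μ ((Fin.append xv ![x, y] : Fin (n + 2) → TorusSite 2 L) (twoPointPlusEnum n 0 i).1)
              ((Fin.append xv ![x, y] : Fin (n + 2) → TorusSite 2 L) (twoPointMinusEnum n 0 j).1)
              (twoPointPlusEnum n 0 i).2 (twoPointMinusEnum n 0 j).2
              ((Fin.append τ ![s, 0] : Fin (n + 2) → ℝ) (twoPointMinusEnum n 0 j).1 -
                (Fin.append τ ![s, 0] : Fin (n + 2) → ℝ) (twoPointPlusEnum n 0 i).1)).det))
        ((Real.exp (-(β * (U * (1 / 2) ^ 2 * Fintype.card (FermionTorus 2 L)))) : ℂ) *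
            (Matrix.gibbsWeight (β - s) (hamiltonianWith (fermionTorusGraph 2 L) 1 U (μ + U * (1 / 2))) *
                creation (orb (FermionTorus.ofTorusSite x) 0) *
              (Matrix.gibbsWeight s (hamiltonianWith (fermionTorusGraph 2 L) 1 U (μ + U * (1 / 2))) *
                annihilation (orb (FermionTorus.ofTorusSite y) 0))).trace /
          Matrix.partitionFn β (hubbardTorusWith 2 L 1 0 μ))) :
    ∀ (G : GeoConsts) (P : SplitConsts) (Q : EngConsts) (R : RenConsts), G.WF → P.WF → Q.WF → R.WF →
      ∃ c₅ : ℝ, 0 < c₅ ∧ ∀ c : ℝ, 0 < c → c ≤ c₅ → ∃ U₀ : ℝ, 0 < U₀ ∧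
        ∀ μ ∈ klWindowC, ∀ U : ℝ, 0 < U → U ≤ U₀ → ∀ β : ℝ, klBetaMin ≤ β → β ≤ Real.exp (c / U ^ 2) →
          ∀ K : TrigPolyC4v, klPredsV12.frameOK R U (nScales β) μ K →
            ∀ (Lstar : ℕ) (Mstar : ℕ → ℕ), TowerP klPredsV12 G P Q R β U μ K Lstar Mstar →
              ∃ B : ℝ, ∃ L₀ : ℕ, ∃ Mth : ℕ → ℕ, ∀ (L : ℕ) [NeZero L], L₀ ≤ L → ∀ (M : ℕ) [NeZero M], Mth L ≤ M →
                ∀ (k : FreqMomentum L M) (σ : Fin 2), ‖klSelfEnergy L M β U μ K klE0 (nScales β + 1) k σ‖ ≤ B :=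
  stub_vl_bound_of_hasSumH1 fun β hβ U μ L _ hL x y s hs => by
    rw [← H1value_graph_eq_torus]
    exact hH1 β hβ U μ L hL x y s hs

/-! ## The raw value form of k3c4-p2's wrapper `hasSum_twoPointTime_of_ae_match` (`V / Z₀`, `Z₀ = Z(dΓ h₀)`, graph-level `V`) -/

omit [NeZero L] in
/-- The free partition function of the wrapper, `Z(dΓ(hubbardOneBody (fermionTorusGraph 2 L) 1 μ))`, is `Z(hubbardTorusWith 2 L 1 0 μ)`. -/
theorem partitionFn_dGamma_hubbardOneBody_eq (β μ : ℝ) :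
    Matrix.partitionFn β (dGamma (hubbardOneBody (fermionTorusGraph 2 L) 1 μ)) = Matrix.partitionFn β (hubbardTorusWith 2 L 1 0 μ) := by
  rw [← hamiltonianWith_zero_eq_dGamma]
  rfl

/-- **`stub_vl_bound` FROM THE RAW WRAPPER FORM OF (H1)**: value `V / Z₀` with `V` = p484918/p490677's graph-level trace factor and
`Z₀ = Z(dΓ(hubbardOneBody (fermionTorusGraph 2 L) 1 μ))` as in `hasSum_twoPointTime_of_ae_match` — no conversion needed on the supplier's side. -/
theorem stub_vl_bound_of_hasSumH1_rawForm
    (hH1 : ∀ β : ℝ, 0 < β → ∀ (U μ : ℝ) (L : ℕ) [NeZero L], 3 ≤ L → ∀ (x y : TorusSite 2 L), ∀ s ∈ Set.Ioo (0 : ℝ) β,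
      HasSum (fun n : ℕ => ((-1 : ℂ) ^ n * ((n ! : ℂ))⁻¹) * ((U : ℂ) ^ n * ∑ xv : Fin n → TorusSite 2 L,
        ∫ τ in Set.Icc (0 : Fin n → ℝ) (fun _ => β),
          (Matrix.of fun i j : Fin (n * 2 + 1) =>
            vertexLimitEntry L β μ ((Fin.append xv ![x, y] : Fin (n + 2) → TorusSite 2 L) (twoPointPlusEnum n 0 i).1)
              ((Fin.append xv ![x, y] : Fin (n + 2) → TorusSite 2 L) (twoPointMinusEnum n 0 j).1)
              (twoPointPlusEnum n 0 i).2 (twoPointMinusEnum n 0 j).2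
              ((Fin.append τ ![s, 0] : Fin (n + 2) → ℝ) (twoPointMinusEnum n 0 j).1 -
                (Fin.append τ ![s, 0] : Fin (n + 2) → ℝ) (twoPointPlusEnum n 0 i).1)).det))
        ((Real.exp (-(β * (U * (1 / 2) ^ 2 * Fintype.card (FermionTorus 2 L)))) : ℂ) *
            (Matrix.gibbsWeight (β - s) (hamiltonianWith (fermionTorusGraph 2 L) 1 U (μ + U * (1 / 2))) *
                creation (orb (FermionTorus.ofTorusSite x) 0) *
              (Matrix.gibbsWeight s (hamiltonianWith (fermionTorusGraph 2 L) 1 U (μ + U * (1 / 2))) *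
                annihilation (orb (FermionTorus.ofTorusSite y) 0))).trace /
          Matrix.partitionFn β (dGamma (hubbardOneBody (fermionTorusGraph 2 L) 1 μ)))) :
    ∀ (G : GeoConsts) (P : SplitConsts) (Q : EngConsts) (R : RenConsts), G.WF → P.WF → Q.WF → R.WF →
      ∃ c₅ : ℝ, 0 < c₅ ∧ ∀ c : ℝ, 0 < c → c ≤ c₅ → ∃ U₀ : ℝ, 0 < U₀ ∧
        ∀ μ ∈ klWindowC, ∀ U : ℝ, 0 < U → U ≤ U₀ → ∀ β : ℝ, klBetaMin ≤ β → β ≤ Real.exp (c / U ^ 2) →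
          ∀ K : TrigPolyC4v, klPredsV12.frameOK R U (nScales β) μ K →
            ∀ (Lstar : ℕ) (Mstar : ℕ → ℕ), TowerP klPredsV12 G P Q R β U μ K Lstar Mstar →
              ∃ B : ℝ, ∃ L₀ : ℕ, ∃ Mth : ℕ → ℕ, ∀ (L : ℕ) [NeZero L], L₀ ≤ L → ∀ (M : ℕ) [NeZero M], Mth L ≤ M →
                ∀ (k : FreqMomentum L M) (σ : Fin 2), ‖klSelfEnergy L M β U μ K klE0 (nScales β + 1) k σ‖ ≤ B :=
  stub_vl_bound_of_hasSumH1_graphForm fun β hβ U μ L _ hL x y s hs => by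
    rw [← partitionFn_dGamma_hubbardOneBody_eq]
    exact hH1 β hβ U μ L hL x y s hs

end Summit.HubbardSuperconductivity.HubbardSuperconductivity.Theorems.TwoPointAssembly

end
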